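import Summits.AtomisticToContinuum.FouriersLaw.Theorems.OddSectorIrreversibilityOddCorrectorDecayVariationAlgebra
import Literature.Analysis.ODE.IntegralGronwall

/-!
# `HiddenChargeMazur.StaticKubo`, line `birth`, stub `stub_twoPointGronwall` — synchronous coupling

Helper file (`--supports stmt-AtomisticToContinuum-13510`, crux decl `HiddenChargeMazur.StaticKubo`,
registered stub `stub_twoPointGronwall` (S1) of the skeleton `Cruxes/StaticKubo/Lines/birth.lean`, rev 4).

Deterministic statement about the pathwise solutions `z_x = chainFlow N x η`, `z_y = chainFlow N y η` of the
pinned anharmonic chain `pinnedChain ω₂ lam β γ` (`ω₂, lam > 0`, `β, γ ≥ 0`) driven by the SAME continuous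
momentum-noise path `η` (additive noise): the forcing `x + (0, η t)` cancels in the difference, which therefore
solves `d(t) = (x - y) + ∫₀ᵗ (Y(z_x) - Y(z_y)) ds` for the Langevin drift `Y`.

* `exists_norm_drift_sub_le` — the drift is Lipschitz between any two phase points with a constant growing
  like the square root of the energies: `‖Y(a) - Y(b)‖ ≤ C₀ (1 + √H(a) + √H(b)) ‖a - b‖` (sup norms).  The
  cubic forces give `|U'(s) - U'(r)| ≤ (ω₂ + 3 lam M)|s - r|`, `|V'(s) - V'(r)| ≤ (1 + 3βM')|s - r|` on squares
  `≤ M, M'` (`ChainVariation.sum_abs_dPotential_sub_le`), and `q_i² ≤ √(4/lam) √H` because `lam q_i⁴/4 ≤ H`.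
* `stub_twoPointGronwall` — Grönwall with the time-dependent rate `C₀(1 + √H(z_x(s)) + √H(z_y(s)))`
  (`Literature.Analysis.ODE.gronwall_integral_le`):
  `‖z_x(t) - z_y(t)‖ ≤ ‖x - y‖ exp(∫₀ᵗ C₀ (1 + √H(z_x s) + √H(z_y s)) ds)`.

References: folklore (synchronous coupling for SDEs with additive noise; Grönwall–Bellman).
-/

noncomputable section

open MeasureTheory Filter Topology
open scoped NNReal ENNReal
open Literature.MathematicalPhysics.KineticTheory.HeatConduction Literature.MathematicalPhysics.KineticTheory
open Literature.Probability.Process OscillatorChain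

namespace Summit.AtomisticToContinuum.FouriersLaw.Cruxes.StaticKubo.Birth.Stubs

attribute [local irreducible] OscillatorChain.chainFlow

variable {ω₂ lam β γ : ℝ}

/-- **Energy-dependent Lipschitz bound of the Langevin drift of the pinned chain** (`ω₂, lam > 0`,
`β, γ ≥ 0`): there is `C₀ ≥ 0` with `‖Y(a) - Y(b)‖ ≤ C₀ (1 + √H(a) + √H(b)) ‖a - b‖` for all phase points
`a, b` (sup norm on `PhaseSpace N`).  From the cubic algebra of `U' = ω₂ q + lam q³`, `V' = r + β r³` and
the quartic confinement `lam q_i⁴ / 4 ≤ H`. [folklore] -/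
theorem exists_norm_drift_sub_le (hω : 0 < ω₂) (hl : 0 < lam) (hβ : 0 ≤ β) (hγ : 0 ≤ γ) (N : ℕ) :
    ∃ C₀ : ℝ, 0 ≤ C₀ ∧ ∀ a b : PhaseSpace N,
      ‖(pinnedChain ω₂ lam β γ).drift N a - (pinnedChain ω₂ lam β γ).drift N b‖ ≤
        C₀ * (1 + Real.sqrt ((pinnedChain ω₂ lam β γ).hamiltonian N a) +
          Real.sqrt ((pinnedChain ω₂ lam β γ).hamiltonian N b)) * ‖a - b‖ := by
  set P := pinnedChain ω₂ lam β γ with hP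
  set c : ℝ := Real.sqrt (4 / lam) with hc
  have hc0 : 0 ≤ c := Real.sqrt_nonneg _
  set K : ℝ := (3 * lam + 48 * β) * c with hK
  have hK0 : 0 ≤ K := by positivity
  refine ⟨1 + 2 * γ + N * (ω₂ + 4) + N * K, by positivity, fun a b => ?_⟩
  set Sa := Real.sqrt (P.hamiltonian N a) with hSa
  set Sb := Real.sqrt (P.hamiltonian N b) with hSb
  have hSa0 : 0 ≤ Sa := Real.sqrt_nonneg _
  have hSb0 : 0 ≤ Sb := Real.sqrt_nonneg _
  -- quartic confinement of the coordinates
  have hsq : ∀ (z : PhaseSpace N) (i : Fin N), z.1 i ^ 2 ≤ c * Real.sqrt (P.hamiltonian N z) := by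
    intro z i
    have hU := pinnedChain_U_le_hamiltonian hω.le hl.le hβ γ N z i
    have h4 : (z.1 i ^ 2) ^ 2 ≤ 4 / lam * P.hamiltonian N z := by
      rw [div_mul_eq_mul_div, le_div_iff₀ hl]
      nlinarith [mul_nonneg hω.le (sq_nonneg (z.1 i))]
    calc z.1 i ^ 2 = Real.sqrt ((z.1 i ^ 2) ^ 2) := (Real.sqrt_sq (sq_nonneg _)).symm
      _ ≤ Real.sqrt (4 / lam * P.hamiltonian N z) := Real.sqrt_le_sqrt h4
      _ = c * Real.sqrt (P.hamiltonian N z) := Real.sqrt_mul (by positivity) _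
  set Mq : ℝ := c * (Sa + Sb) with hMq
  have hMq0 : 0 ≤ Mq := by positivity
  have hqa : ∀ i, a.1 i ^ 2 ≤ Mq := fun i =>
    (hsq a i).trans (by simp only [hMq]; nlinarith [mul_nonneg hc0 hSb0])
  have hqb : ∀ i, b.1 i ^ 2 ≤ Mq := fun i =>
    (hsq b i).trans (by simp only [hMq]; nlinarith [mul_nonneg hc0 hSa0])
  have hra : ∀ k l : Fin N, l.val = k.val + 1 → (a.1 l - a.1 k) ^ 2 ≤ 4 * Mq := fun k l _ => by
    nlinarith [hqa k, hqa l, sq_nonneg (a.1 l + a.1 k)]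
  have hrb : ∀ k l : Fin N, l.val = k.val + 1 → (b.1 l - b.1 k) ^ 2 ≤ 4 * Mq := fun k l _ => by
    nlinarith [hqb k, hqb l, sq_nonneg (b.1 l + b.1 k)]
  -- the `ℓ¹` force bound of the tree, then `ℓ¹ ≤ N · sup`
  have hforce := Summit.AtomisticToContinuum.FouriersLaw.Theorems.ChainVariation.sum_abs_dPotential_sub_le
    hω.le hl.le hβ γ (Mq := Mq) (Mr := 4 * Mq) (by positivity) a.1 b.1 hqa hqb hra hrb
  have hab1 : ∀ i, |a.1 i - b.1 i| ≤ ‖a - b‖ := fun i => by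
    rw [← Real.norm_eq_abs]
    exact (norm_le_pi_norm (a - b).1 i).trans (norm_fst_le (a - b))
  have hab2 : ∀ i, |a.2 i - b.2 i| ≤ ‖a - b‖ := fun i => by
    rw [← Real.norm_eq_abs]
    exact (norm_le_pi_norm (a - b).2 i).trans (norm_snd_le (a - b))
  have hsum1 : ∑ i, |a.1 i - b.1 i| ≤ N * ‖a - b‖ := by
    calc ∑ i, |a.1 i - b.1 i| ≤ ∑ _i : Fin N, ‖a - b‖ := Finset.sum_le_sum fun i _ => hab1 i
      _ = N * ‖a - b‖ := by simp
  have hFi : ∀ i, |P.dPotential N i a.1 - P.dPotential N i b.1| ≤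
      N * (ω₂ + 4 + K * (Sa + Sb)) * ‖a - b‖ := by
    intro i
    calc |P.dPotential N i a.1 - P.dPotential N i b.1|
        ≤ ∑ j, |P.dPotential N j a.1 - P.dPotential N j b.1| :=
          Finset.single_le_sum (f := fun j => |P.dPotential N j a.1 - P.dPotential N j b.1|)
            (fun j _ => abs_nonneg _) (Finset.mem_univ i)
      _ ≤ (ω₂ + 3 * lam * Mq + 4 * (1 + 3 * β * (4 * Mq))) * ∑ j, |a.1 j - b.1 j| := hforce
      _ = (ω₂ + 4 + K * (Sa + Sb)) * ∑ j, |a.1 j - b.1 j| := by simp only [hK, hMq]; ring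
      _ ≤ (ω₂ + 4 + K * (Sa + Sb)) * (N * ‖a - b‖) :=
          mul_le_mul_of_nonneg_left hsum1 (by positivity)
      _ = N * (ω₂ + 4 + K * (Sa + Sb)) * ‖a - b‖ := by ring
  -- the drift, componentwise
  have hUd : Differentiable ℝ P.U :=
    (pinnedChain_contDiff_U ω₂ lam β γ (n := 1)).differentiable one_ne_zero
  have hVd : Differentiable ℝ P.V :=
    (pinnedChain_contDiff_V ω₂ lam β γ (n := 1)).differentiable one_ne_zero
  have hw0 : ∀ i : Fin N, 0 ≤ bathWeight N i := fun i => by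
    unfold bathWeight; split_ifs <;> norm_num
  have hw2 : ∀ i : Fin N, bathWeight N i ≤ 2 := fun i => by
    unfold bathWeight; split_ifs <;> norm_num
  have hγP : P.γ = γ := rfl
  have hscal : N * (ω₂ + 4 + K * (Sa + Sb)) + 2 * γ ≤
      (1 + 2 * γ + N * (ω₂ + 4) + N * K) * (1 + Sa + Sb) := by
    have h1 : 0 ≤ (1 + 2 * γ + N * (ω₂ + 4)) * (Sa + Sb) := by positivity
    nlinarith [h1, mul_nonneg (Nat.cast_nonneg N) hK0]
  have hone : 1 ≤ (1 + 2 * γ + N * (ω₂ + 4) + N * K) * (1 + Sa + Sb) := by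
    have h1 : 1 ≤ 1 + 2 * γ + N * (ω₂ + 4) + N * K := by
      have : 0 ≤ 2 * γ + N * (ω₂ + 4) + N * K := by positivity
      linarith
    have h2 : 1 ≤ 1 + Sa + Sb := by linarith
    nlinarith
  rw [P.drift_eq hUd hVd]
  rw [Prod.mk_sub_mk, Prod.norm_mk, max_le_iff]
  constructor
  · calc ‖a.2 - b.2‖ = ‖(a - b).2‖ := rfl
      _ ≤ ‖a - b‖ := norm_snd_le (a - b)
      _ = 1 * ‖a - b‖ := (one_mul _).symm
      _ ≤ _ := mul_le_mul_of_nonneg_right hone (norm_nonneg _)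
  · refine (pi_norm_le_iff_of_nonneg (by positivity)).2 fun i => ?_
    rw [Pi.sub_apply, Real.norm_eq_abs, hγP]
    have e : -P.dPotential N i a.1 - γ * bathWeight N i * a.2 i -
        (-P.dPotential N i b.1 - γ * bathWeight N i * b.2 i) =
        -((P.dPotential N i a.1 - P.dPotential N i b.1) + γ * bathWeight N i * (a.2 i - b.2 i)) := by
      ring
    rw [e, abs_neg]
    have hfr : |γ * bathWeight N i * (a.2 i - b.2 i)| ≤ 2 * γ * ‖a - b‖ := by
      rw [abs_mul, abs_mul, abs_of_nonneg hγ, abs_of_nonneg (hw0 i)]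
      calc γ * bathWeight N i * |a.2 i - b.2 i| ≤ γ * 2 * ‖a - b‖ :=
            mul_le_mul (mul_le_mul_of_nonneg_left (hw2 i) hγ) (hab2 i) (abs_nonneg _) (by positivity)
        _ = 2 * γ * ‖a - b‖ := by ring
    calc |(P.dPotential N i a.1 - P.dPotential N i b.1) + γ * bathWeight N i * (a.2 i - b.2 i)|
        ≤ |P.dPotential N i a.1 - P.dPotential N i b.1| + |γ * bathWeight N i * (a.2 i - b.2 i)| :=
          abs_add_le _ _
      _ ≤ N * (ω₂ + 4 + K * (Sa + Sb)) * ‖a - b‖ + 2 * γ * ‖a - b‖ := add_le_add (hFi i) hfr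
      _ = (N * (ω₂ + 4 + K * (Sa + Sb)) + 2 * γ) * ‖a - b‖ := by ring
      _ ≤ _ := mul_le_mul_of_nonneg_right hscal (norm_nonneg _)

/-- **S1 — `stub_twoPointGronwall` (synchronous coupling, deterministic), proved.** For the pinned chain
(`ω₂, lam > 0`, `β, γ ≥ 0`) and ANY continuous momentum-noise path `η`, two pathwise solutions `chainFlow`
started at `x, y` and driven by the SAME `η` satisfy
`‖z_x(t) − z_y(t)‖ ≤ ‖x − y‖ exp(∫₀ᵗ C₀(1 + √H(z_x(s)) + √H(z_y(s))) ds)` for `t ≥ 0`: the forcing cancels in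
the difference, `d(t) = (x - y) + ∫₀ᵗ (Y(z_x) - Y(z_y))`, the drift difference is bounded by
`C₀(1 + √H(z_x) + √H(z_y)) ‖d‖` (`exists_norm_drift_sub_le`), and Grönwall with a time-dependent rate
(`Literature.Analysis.ODE.gronwall_integral_le`) concludes. [folklore] -/
theorem stub_twoPointGronwall :
    ∀ ω₂ lam β γ : ℝ, 0 < ω₂ → 0 < lam → 0 ≤ β → 0 ≤ γ → ∀ N : ℕ, ∃ C₀ : ℝ, 0 ≤ C₀ ∧
      ∀ η : ℝ → Fin N → ℝ, Continuous η → ∀ (x y : PhaseSpace N) (t : ℝ), 0 ≤ t →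
        ‖(pinnedChain ω₂ lam β γ).chainFlow N x η t - (pinnedChain ω₂ lam β γ).chainFlow N y η t‖ ≤
          ‖x - y‖ * Real.exp (∫ s in (0 : ℝ)..t, C₀ * (1 +
            Real.sqrt ((pinnedChain ω₂ lam β γ).hamiltonian N ((pinnedChain ω₂ lam β γ).chainFlow N x η s)) +
            Real.sqrt ((pinnedChain ω₂ lam β γ).hamiltonian N ((pinnedChain ω₂ lam β γ).chainFlow N y η s)))) := by
  intro ω₂ lam β γ hω hl hβ hγ N
  obtain ⟨C₀, hC₀, hLip⟩ := exists_norm_drift_sub_le hω hl hβ hγ N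
  refine ⟨C₀, hC₀, fun η hη x y t ht => ?_⟩
  set P := pinnedChain ω₂ lam β γ with hP
  have hsx := pinnedChain_isIntegralSolutionOn_chainFlow hω hl.le hβ hγ N x hη t
  have hsy := pinnedChain_isIntegralSolutionOn_chainFlow hω hl.le hβ hγ N y hη t
  have hzxc : Continuous (P.chainFlow N x η) := pinnedChain_continuous_chainFlow hω hl.le hβ hγ N x hη
  have hzyc : Continuous (P.chainFlow N y η) := pinnedChain_continuous_chainFlow hω hl.le hβ hγ N y hη
  set zx : ℝ → PhaseSpace N := P.chainFlow N x η with hzx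
  set zy : ℝ → PhaseSpace N := P.chainFlow N y η with hzy
  have hYc : Continuous (P.drift N) := (pinnedChain_contDiff_drift ω₂ lam β γ N (n := 0)).continuous
  have hHc : Continuous (P.hamiltonian N) := pinnedChain_continuous_hamiltonian ω₂ lam β γ N
  -- the data of the Grönwall argument
  set g : ℝ → ℝ := fun u => ‖zx u - zy u‖ with hg
  set A : ℝ → ℝ := fun u =>
    C₀ * (1 + Real.sqrt (P.hamiltonian N (zx u)) + Real.sqrt (P.hamiltonian N (zy u))) with hA
  have hgc : Continuous g := (hzxc.sub hzyc).norm
  have hAc : Continuous A :=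
    continuous_const.mul ((continuous_const.add (hHc.comp hzxc).sqrt).add (hHc.comp hzyc).sqrt)
  have hA0 : ∀ u, 0 ≤ A u := fun u => by positivity
  have hle : ∀ u ∈ Set.Icc 0 t, g u ≤ ‖x - y‖ + ∫ s in (0:ℝ)..u, A s * g s := by
    intro u hu
    have hix : IntervalIntegrable (fun s => P.drift N (zx s)) volume 0 u :=
      (hYc.comp hzxc).intervalIntegrable _ _
    have hiy : IntervalIntegrable (fun s => P.drift N (zy s)) volume 0 u :=
      (hYc.comp hzyc).intervalIntegrable _ _
    have h1 : zx u = forcing x η u + ∫ s in (0:ℝ)..u, P.drift N (zx s) := hsx u hu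
    have h2 : zy u = forcing y η u + ∫ s in (0:ℝ)..u, P.drift N (zy s) := hsy u hu
    have heq : zx u - zy u = (x - y) + ∫ s in (0:ℝ)..u, (P.drift N (zx s) - P.drift N (zy s)) := by
      rw [intervalIntegral.integral_sub hix hiy, h1, h2, ← forcing_sub_forcing x y η u]
      abel
    show ‖zx u - zy u‖ ≤ ‖x - y‖ + ∫ s in (0:ℝ)..u, A s * g s
    rw [heq]
    calc ‖(x - y) + ∫ s in (0:ℝ)..u, (P.drift N (zx s) - P.drift N (zy s))‖
        ≤ ‖x - y‖ + ‖∫ s in (0:ℝ)..u, (P.drift N (zx s) - P.drift N (zy s))‖ := norm_add_le _ _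
      _ ≤ ‖x - y‖ + ∫ s in (0:ℝ)..u, A s * g s := by
          refine add_le_add le_rfl (intervalIntegral.norm_integral_le_of_norm_le hu.1
            (Eventually.of_forall fun s _ => ?_) ((hAc.mul hgc).intervalIntegrable _ _))
          exact hLip (zx s) (zy s)
  have hmono : MonotoneOn (fun _ : ℝ => ‖x - y‖) (Set.Icc 0 t) := fun _ _ _ _ _ => le_rfl
  exact Literature.Analysis.ODE.gronwall_integral_le (h := fun _ => ‖x - y‖) ht hAc hgc hA0 hmono hle

end Summit.AtomisticToContinuum.FouriersLaw.Cruxes.StaticKubo.Birth.Stubs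

end
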